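import Literature.AlgebraicGeometry.Motives.MixedHodgeStructureLoewyLength
import HarnessLib

/-!
# Socle, radical and Loewy length of a graded-polarizable MHS in terms of `ℚ`-splitting

For graded-polarizable mixed Hodge structures "semisimple" means "`ℚ`-split" (Cattani–El Zein–Griffiths–Lê,
Ch. 12 footnote 2, p. 527: the direct sums of Hodge structures "are precisely the `ℚ`-split mixed Hodge structures
(no nontrivial extensions)"; Jannsen, LNM 1400, Thm. 7.9 (proof): the `Gr^W_n` are semisimple; the tree's
`IsGradedPolarizable.isSemisimple_iff_isSplitOverQ`). Consequently, for graded-polarizable `H`: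

* **`soc H` is the largest `ℚ`-split sub-MHS** (`le_socle_iff_isSplitOverQ`), and contains every pure sub-MHS;
* **`rad H` is the smallest sub-MHS with `ℚ`-split quotient** (`radical_le_iff_isSplitOverQ_quotient`);
* `H` is `ℚ`-split iff `soc H = H` iff `rad H = 0` iff `ℓ(H) ≤ 1`; `ℓ(H) ≤ 2` iff `H / soc H` is `ℚ`-split iff
  `rad H` is `ℚ`-split.

Namespace `MixedHodgeStructure`; everything proved, no named facts.

## References

* [CattaniElZeinGriffithsLe2014] E. Cattani et al. (eds.), Hodge Theory (2014), Thm. 3.2.18, p. 270, Ch. 12 fn. 2 (p. 527).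
* [Jannsen1990MixedMotives] U. Jannsen, Mixed Motives and Algebraic K-Theory, LNM 1400 (1990), Thm. 7.9.
* [Carlson1980] J. Carlson, Extensions of mixed Hodge structures (Angers 1979), §2(a).
-/

noncomputable section

namespace Literature.AlgebraicGeometry.Motives

namespace MixedHodgeStructure

universe u

variable {V : Type u} [AddCommGroup V] [Module ℚ V] [FiniteDimensional ℚ V]
variable {H : MixedHodgeStructure V}

open Module

/-! ### §1 Sub-MHS and quotients: semisimple iff `ℚ`-split -/

/-- A sub-MHS of a graded-polarizable MHS is semisimple iff it is `ℚ`-split. [cite: CattaniElZeinGriffithsLe2014, Ch. 12 footnote 2 (p. 527)]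
[cite: Carlson1980, §2(a)] -/
theorem IsGradedPolarizable.isSemisimple_sub_iff_isSplitOverQ (hp : H.IsGradedPolarizable) (S : SubMixedHodgeStructure H) :
    S.toMixedHodgeStructure.IsSemisimple ↔ S.toMixedHodgeStructure.IsSplitOverQ :=
  (hp.of_injective S.subtype (Submodule.injective_subtype _)).isSemisimple_iff_isSplitOverQ

/-- A quotient of a graded-polarizable MHS is semisimple iff it is `ℚ`-split. [cite: CattaniElZeinGriffithsLe2014, Ch. 12 footnote 2 (p. 527)]
[cite: Carlson1980, §2(a)] -/
theorem IsGradedPolarizable.isSemisimple_quotient_iff_isSplitOverQ (hp : H.IsGradedPolarizable)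
    (S : SubMixedHodgeStructure H) : S.quotient.IsSemisimple ↔ S.quotient.IsSplitOverQ :=
  (hp.of_surjective S.mkQ (Submodule.mkQ_surjective _)).isSemisimple_iff_isSplitOverQ

/-! ### §2 The socle is the largest `ℚ`-split sub-MHS, the radical the smallest sub-MHS with `ℚ`-split quotient -/

/-- **Graded-polarizable: `S ⊆ soc H ↔ S` is `ℚ`-split.** [cite: CattaniElZeinGriffithsLe2014, p. 270 and Ch. 12 footnote 2 (p. 527)] -/
theorem IsGradedPolarizable.le_socle_iff_isSplitOverQ (hp : H.IsGradedPolarizable) (S : SubMixedHodgeStructure H) :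
    S.toSubmodule ≤ (socle H).toSubmodule ↔ S.toMixedHodgeStructure.IsSplitOverQ := by
  rw [← isSemisimple_iff_le_socle, hp.isSemisimple_sub_iff_isSplitOverQ]

/-- **Graded-polarizable: `rad H ⊆ S ↔ H/S` is `ℚ`-split.** [cite: CattaniElZeinGriffithsLe2014, p. 270 and Ch. 12 footnote 2 (p. 527)] -/
theorem IsGradedPolarizable.radical_le_iff_isSplitOverQ_quotient (hp : H.IsGradedPolarizable)
    (S : SubMixedHodgeStructure H) : (radical H).toSubmodule ≤ S.toSubmodule ↔ S.quotient.IsSplitOverQ := by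
  rw [← isSemisimple_quotient_iff_radical_le, hp.isSemisimple_quotient_iff_isSplitOverQ]

/-- The maximal semisimple quotient `H / rad H` is `ℚ`-split. [cite: CattaniElZeinGriffithsLe2014, p. 270] -/
theorem isSplitOverQ_radical_quotient : (radical H).quotient.IsSplitOverQ :=
  (isSemisimple_quotient_radical H).isSplitOverQ

/-- **Every pure sub-MHS of a graded-polarizable MHS lies in the socle** (it is pure polarizable, hence semisimple).
[cite: Jannsen1990MixedMotives, Thm. 7.9 (proof)] [cite: CattaniElZeinGriffithsLe2014, p. 270] -/
theorem IsGradedPolarizable.le_socle_of_isPure (hp : H.IsGradedPolarizable) (S : SubMixedHodgeStructure H) {n : ℤ}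
    (hS : S.toMixedHodgeStructure.IsPure n) : S.toSubmodule ≤ (socle H).toSubmodule :=
  le_socle S ((hp.of_injective S.subtype (Submodule.injective_subtype _)).isSemisimple_of_forall_W_eq_bot_or_eq_top
    fun k => (lt_or_ge k n).elim (fun hk => Or.inl (hS.1 k hk)) fun hk => Or.inr (hS.2 k hk))

/-- Dually, **`rad H ⊆ S` whenever `H/S` is pure**. [cite: Jannsen1990MixedMotives, Thm. 7.9 (proof)] [cite: CattaniElZeinGriffithsLe2014, p. 270] -/
theorem IsGradedPolarizable.radical_le_of_isPure_quotient (hp : H.IsGradedPolarizable) (S : SubMixedHodgeStructure H)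
    {n : ℤ} (hS : S.quotient.IsPure n) : (radical H).toSubmodule ≤ S.toSubmodule :=
  radical_le S ((hp.of_surjective S.mkQ (Submodule.mkQ_surjective _)).isSemisimple_of_forall_W_eq_bot_or_eq_top
    fun k => (lt_or_ge k n).elim (fun hk => Or.inl (hS.1 k hk)) fun hk => Or.inr (hS.2 k hk))

/-! ### §3 `ℚ`-splitting read off the socle, the radical, the Loewy length -/

/-- **Graded-polarizable: `H` is `ℚ`-split iff `soc H = H`.** [cite: CattaniElZeinGriffithsLe2014, Ch. 12 footnote 2 (p. 527)] -/
theorem IsGradedPolarizable.socle_eq_top_iff_isSplitOverQ (hp : H.IsGradedPolarizable) :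
    (socle H).toSubmodule = ⊤ ↔ H.IsSplitOverQ := by
  rw [socle_eq_top_iff, hp.isSemisimple_iff_isSplitOverQ]

/-- **Graded-polarizable: `H` is `ℚ`-split iff `rad H = 0`.** [cite: CattaniElZeinGriffithsLe2014, Ch. 12 footnote 2 (p. 527)] -/
theorem IsGradedPolarizable.radical_eq_bot_iff_isSplitOverQ (hp : H.IsGradedPolarizable) :
    (radical H).toSubmodule = ⊥ ↔ H.IsSplitOverQ := by
  rw [radical_eq_bot_iff, hp.isSemisimple_iff_isSplitOverQ]

/-- **Graded-polarizable: `ℓ(H) ≤ 1 ↔ H` is `ℚ`-split.** [cite: CattaniElZeinGriffithsLe2014, Ch. 12 footnote 2 (p. 527)] -/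
theorem IsGradedPolarizable.loewyLength_le_one_iff_isSplitOverQ (hp : H.IsGradedPolarizable) :
    loewyLength H ≤ 1 ↔ H.IsSplitOverQ := by
  rw [loewyLength_le_one_iff, hp.isSemisimple_iff_isSplitOverQ]

/-- A `ℚ`-split graded-polarizable MHS has Loewy length `≤ 1`. [cite: CattaniElZeinGriffithsLe2014, Ch. 12 footnote 2 (p. 527)] -/
theorem IsSplitOverQ.loewyLength_le_one (hs : H.IsSplitOverQ) (hp : H.IsGradedPolarizable) : loewyLength H ≤ 1 :=
  hp.loewyLength_le_one_iff_isSplitOverQ.2 hs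

/-- **Graded-polarizable: `ℓ(H) ≤ 2 ↔ H / soc H` is `ℚ`-split.** [cite: CattaniElZeinGriffithsLe2014, p. 270 and Ch. 12 footnote 2 (p. 527)] -/
theorem IsGradedPolarizable.loewyLength_le_two_iff_isSplitOverQ_socle_quotient (hp : H.IsGradedPolarizable) :
    loewyLength H ≤ 2 ↔ (socle H).quotient.IsSplitOverQ := by
  rw [loewyLength_le_iff, ← hp.isSemisimple_quotient_iff_isSplitOverQ, ← socleSeries_one]
  exact ⟨isSemisimple_quotient_of_socleSeries_succ_eq_top H 1, socleSeries_succ_eq_top_of_isSemisimple H 1⟩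

/-- **Graded-polarizable: `ℓ(H) ≤ 2 ↔ rad H` is `ℚ`-split.** [cite: CattaniElZeinGriffithsLe2014, p. 270 and Ch. 12 footnote 2 (p. 527)] -/
theorem IsGradedPolarizable.loewyLength_le_two_iff_isSplitOverQ_radical (hp : H.IsGradedPolarizable) :
    loewyLength H ≤ 2 ↔ (radical H).toMixedHodgeStructure.IsSplitOverQ := by
  rw [loewyLength_le_iff_radicalSeries_eq_bot, ← hp.isSemisimple_sub_iff_isSplitOverQ, ← radicalSeries_one]
  exact ⟨isSemisimple_of_radicalSeries_succ_eq_bot H 1, radicalSeries_succ_eq_bot_of_isSemisimple H 1⟩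

/-- In general (no polarizability): `ℓ(H) ≤ 2 ↔ H / soc H` is semisimple. [cite: CattaniElZeinGriffithsLe2014, p. 270] -/
theorem loewyLength_le_two_iff_isSemisimple_socle_quotient : loewyLength H ≤ 2 ↔ (socle H).quotient.IsSemisimple := by
  rw [loewyLength_le_iff, ← socleSeries_one]
  exact ⟨isSemisimple_quotient_of_socleSeries_succ_eq_top H 1, socleSeries_succ_eq_top_of_isSemisimple H 1⟩

/-- In general: `ℓ(H) ≤ 2 ↔ rad H` is semisimple. [cite: CattaniElZeinGriffithsLe2014, p. 270] -/
theorem loewyLength_le_two_iff_isSemisimple_radical :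
    loewyLength H ≤ 2 ↔ (radical H).toMixedHodgeStructure.IsSemisimple := by
  rw [loewyLength_le_iff_radicalSeries_eq_bot, ← radicalSeries_one]
  exact ⟨isSemisimple_of_radicalSeries_succ_eq_bot H 1, radicalSeries_succ_eq_bot_of_isSemisimple H 1⟩

/-- In general: `ℓ(H) ≤ 2 ↔ rad H ⊆ soc H`. [cite: CattaniElZeinGriffithsLe2014, p. 270] -/
theorem loewyLength_le_two_iff_radical_le_socle :
    loewyLength H ≤ 2 ↔ (radical H).toSubmodule ≤ (socle H).toSubmodule := by
  rw [loewyLength_le_two_iff_isSemisimple_radical, isSemisimple_iff_le_socle]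

end MixedHodgeStructure

end Literature.AlgebraicGeometry.Motives
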